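import Literature.NumberTheory.EllipticCurves.Kato2004.IwasawaH1RankLowerBound
import Literature.NumberTheory.EllipticCurves.Kato2004.IwasawaH1RankLeOneProofs
import HarnessLib

/-!
# Companion proofs for `Kato2004.one_le_rank_iwasawaH1` (Kato (12.2.2), the lower bound
# `1 ≤ rank_Λ 𝐇¹_Γ(T_pW)`): monotonicity from `thm12_4`, the two (NT) currencies, and the consumers'
# triple at a pin — proofs only

Topic `NumberTheory/EllipticCurves`, sub-directory `Kato2004` (namespace = path).  Cell `bsd-cn100`, prover
seat `bsd-cn100-s2-c3` (g12); text = the plan g20 kit sketch (`V1hSketch`, sha256 1367f531…) moved to the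
path namespace and importing the landed statement file instead of a copy of the def.  THEOREMS ONLY.

* `one_le_rank_iwasawaH1_of_thm12_4 : thm12_4 → one_le_rank_iwasawaH1` — the ACT TEST (i) MONOTONICITY
  certificate for the v1h re-cut (`thm12_4` ↦ `one_le_rank_iwasawaH1` in `stub_refereedInputs` of the
  registered `kato-zeta-perrin-riou` lines on stmt-BirchSwinnertonDyer-19080 / -19160): the substitute is WEAKER.
* `nontrivial_of_one_le_rank_iwasawaH1` — (NT) currency «`𝐇¹_Γ(T_pW) ≠ 0`» from the fact (no hypothesis);
  `one_le_rank_iwasawaH1_of_nontrivial` — the converse at a pin, under the tree theorem `isTorsionFree`;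
  `nontrivial_iwasawaH1_iff_one_le_rank` — the two currencies agree pin by pin.
* `IwasawaH1Data.thm12_4_clauses_of_one_le_rank_of_rank_integralH1_le_one` — the consumers' triple AT A PIN,
  `Module.Finite Λ 𝐇¹ ∧ (IsTorsionFree ∧ rank = 1)`, from the fact and the displayed base-level bound
  `rank_{ℤ_p} H¹(ℤ[1/p], T_pW) ≤ 1` ((R2), `thm12_4_clauses_of_nontrivial_of_rank_integralH1_le_one`, p514042).
* `finite_descentCokernel_of_rankOne_of_one_le_rank_of_rank_le_one` — the former RI conjunct from the fact and (R1) displayed.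

HONEST FRAMING: the fact `one_le_rank_iwasawaH1` is NOT proved here (it is Kato's (12.2.2), Tate's global
Euler–Poincaré characteristic up the tower); nothing about Thm. 12.4 (1), the Main Conjecture, the
Perrin-Riou formula, crux B or BSD.  No `instance`, no notation.

References: K. Kato, Astérisque 295 (2004), §12.2 (12.2.2) (p. 220), Thm. 12.4 (2) (p. 221) [Kato2004Asterisque];
tree: `Kato2004/IwasawaH1RankLowerBound.lean` (the fact), `Kato2004/IwasawaH1RankLeOneProofs.lean` ((R2)),
`Kato2004/IwasawaH1LambdaTorsionFreeProofs.lean` (`isTorsionFree`).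
-/

noncomputable section

namespace Literature.NumberTheory.EllipticCurves.Kato2004

open Field Literature.NumberTheory.GaloisRepresentations Literature.NumberTheory.EllipticCurves
  Literature.NumberTheory.EllipticCurves.Kato2004.EulerSystemValues

/-- **ACT TEST (i): the substitute is WEAKER than the replaced conjunct** — `thm12_4` (whose Thm. 12.4 (2)
clause gives `rank_Λ 𝐇¹ = 1`) implies `one_le_rank_iwasawaH1`.
[cite: Kato2004Asterisque, Thm. 12.4 (2) (p. 221) and §12.2 (12.2.2) (p. 220)] -/
theorem one_le_rank_iwasawaH1_of_thm12_4 (h : thm12_4) : one_le_rank_iwasawaH1 :=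
  fun W _ p _ _ κ γ hκ hγ I => (h W p κ γ hκ hγ I).2.1.2.ge

/-- **(NT) currency**: `one_le_rank_iwasawaH1` gives `Nontrivial 𝐇¹_Γ(T_pW)` at every cyclotomic pin (no
hypothesis needed in this direction). [cite: Kato2004Asterisque, §12.2 (12.2.2) (p. 220)] -/
theorem nontrivial_of_one_le_rank_iwasawaH1 (h : one_le_rank_iwasawaH1) :
    ∀ (W : WeierstrassCurve ℚ) [W.IsElliptic] (p : ℕ) [Fact p.Prime]
      [ContinuousSMul ℤ_[p] (W.tateModule p)] (κ : ZpExtension ℚ p) (γ : absoluteGaloisGroup ℚ),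
      κ.IsCyclotomic → κ.IsTopGenerator γ → ∀ I : IwasawaH1Data W p κ γ, Nontrivial I.H := by
  intro W _ p _ _ κ γ hκ hγ I
  by_contra hnt
  rw [not_nontrivial_iff_subsingleton] at hnt
  have h0 : Module.rank (IwasawaAlgebra p) I.H = 0 := rank_subsingleton' _ _
  have h1 := h W p κ γ hκ hγ I
  rw [h0] at h1
  exact not_lt.mpr h1 zero_lt_one

/-- **Converse currency at a pin**: `Nontrivial 𝐇¹_Γ(T_pW)` gives `1 ≤ rank_Λ 𝐇¹_Γ(T_pW)` (the module is
torsion free: tree theorem `IwasawaH1Data.isTorsionFree`; `rank_pos`).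
[cite: Kato2004Asterisque, Thm. 12.4 (2) (p. 221)] -/
theorem one_le_rank_iwasawaH1_of_nontrivial {W : WeierstrassCurve ℚ} [W.IsElliptic] {p : ℕ} [Fact p.Prime]
    [ContinuousSMul ℤ_[p] (W.tateModule p)] {κ : ZpExtension ℚ p} {γ : absoluteGaloisGroup ℚ}
    (hγ : κ.IsTopGenerator γ) (I : IwasawaH1Data W p κ γ) [Nontrivial I.H] :
    1 ≤ Module.rank (IwasawaAlgebra p) I.H := by
  haveI := I.isTorsionFree hγ
  exact Cardinal.one_le_iff_pos.mpr rank_pos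

/-- **The two currencies agree pin by pin**: at a cyclotomic pin, `Nontrivial 𝐇¹ ↔ 1 ≤ rank_Λ 𝐇¹`.
[cite: Kato2004Asterisque, Thm. 12.4 (2) (p. 221)] -/
theorem nontrivial_iwasawaH1_iff_one_le_rank {W : WeierstrassCurve ℚ} [W.IsElliptic] {p : ℕ} [Fact p.Prime]
    [ContinuousSMul ℤ_[p] (W.tateModule p)] {κ : ZpExtension ℚ p} {γ : absoluteGaloisGroup ℚ}
    (hγ : κ.IsTopGenerator γ) (I : IwasawaH1Data W p κ γ) :
    Nontrivial I.H ↔ 1 ≤ Module.rank (IwasawaAlgebra p) I.H := by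
  refine ⟨fun h => one_le_rank_iwasawaH1_of_nontrivial hγ I, fun h1 => ?_⟩
  by_contra hnt
  rw [not_nontrivial_iff_subsingleton] at hnt
  have h0 : Module.rank (IwasawaAlgebra p) I.H = 0 := rank_subsingleton' _ _
  rw [h0] at h1
  exact not_lt.mpr h1 zero_lt_one

/-- **The consumers' triple AT A PIN** from the fact and the displayed base-level bound ((R2)'s hypothesis
`rank_{ℤ_p} H¹(ℤ[1/p], T_pW) ≤ 1`): `Module.Finite Λ 𝐇¹ ∧ (Module.IsTorsionFree Λ 𝐇¹ ∧ Module.rank Λ 𝐇¹ = 1)`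
— exactly what `readingRK_of_facts` destructures from `thm12_4 W p κ γ hκ hγ I`.
[cite: Kato2004Asterisque, §12.2 (12.2.1)–(12.2.2) (p. 220) and Thm. 12.4 (2) (p. 221)] -/
theorem IwasawaH1Data.thm12_4_clauses_of_one_le_rank_of_rank_integralH1_le_one (h : one_le_rank_iwasawaH1)
    {W : WeierstrassCurve ℚ} [W.IsElliptic] {p : ℕ} [Fact p.Prime]
    [ContinuousSMul ℤ_[p] (W.tateModule p)] {κ : ZpExtension ℚ p} {γ : absoluteGaloisGroup ℚ}
    (hκ : κ.IsCyclotomic) (hγ : κ.IsTopGenerator γ) (I : IwasawaH1Data W p κ γ)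
    (hrank : Module.rank ℤ_[p] (integralH1 (tateRep W p) p (κ.layerSubgroup 0)) ≤ 1) :
    Module.Finite (IwasawaAlgebra p) I.H ∧
      (Module.IsTorsionFree (IwasawaAlgebra p) I.H ∧ Module.rank (IwasawaAlgebra p) I.H = 1) := by
  haveI : Nontrivial I.H := nontrivial_of_one_le_rank_iwasawaH1 h W p κ γ hκ hγ I
  exact I.thm12_4_clauses_of_nontrivial_of_rank_integralH1_le_one hκ hγ hrank

/-- **The former RI conjunct `finite_descentCokernel_of_rankOne` from the fact and (R1) displayed** —
`finite_descentCokernel_of_rankOne_of_nontrivial_of_rank_le_one` (p514042) with (NT) supplied by the fact.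
[cite: Kato2004Asterisque, §14.14 (14.14.1) (p. 243) and §12.2 (12.2.2) (p. 220)] -/
theorem finite_descentCokernel_of_rankOne_of_one_le_rank_of_rank_le_one (h : one_le_rank_iwasawaH1)
    (hR1 : ∀ (W : WeierstrassCurve ℚ) [W.IsElliptic] (p : ℕ) [Fact p.Prime]
      [ContinuousSMul ℤ_[p] (W.tateModule p)] (κ : ZpExtension ℚ p),
      W.mordellWeilRank = 1 → Finite (AddCommGroup.primaryComponent W.sha p) →
        Module.rank ℤ_[p] (integralH1 (tateRep W p) p (κ.layerSubgroup 0)) ≤ 1) :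
    finite_descentCokernel_of_rankOne :=
  finite_descentCokernel_of_rankOne_of_nontrivial_of_rank_le_one (nontrivial_of_one_le_rank_iwasawaH1 h) hR1

end Literature.NumberTheory.EllipticCurves.Kato2004

end
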